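import Mathlib
import Summits.ResolutionOfSingularities.ResolutionOfSingularities.Theorems.HomologicalConductorPersistenceStaircaseResolution
import HarnessLib

/-!
# Rung S-2 `PersistenceSurface` (stmt-19970), stub C1 (`Sat₄`) — the RECORD STAIRCASE of a weight class:
# every isotypic piece `M_a` of `k[u,v]` over `U = k[u,v]^{μ_n(1,q)}` is generated by a monomial staircase, so it
# has an explicit first syzygy `Π_t M_{ψ_t}` (chain W4.4b, seat res-L1-w44b-stub-4 gen 6; T-V package part 22 =
# SYZYGY-PLAN S1)

[OURS · L1 w44b · rung S-2] Nothing here is a statement of the manuscript under review (Hironaka 2017);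
AI-written, weaker than expert review.

Part 21 (`…PersistenceStaircaseResolution.isSyzygy_one_staircase`) resolves a piece `M_a` generated by a monomial
staircase.  This file produces the staircase (res-L1-w44b-idea-1 SC-TORIC §2(e)(1): «the minimal generators of
`M_χ` are `u^{c_j} v^j` at the RECORD positions of `c_j = (χ − qj) mod n`»):

* `exists_record_enum` — pure combinatorics: for `f : ℕ → ℕ` and `J`, an increasing enumeration `e_0 = 0 < e_1 <
  … < e_μ` of the record positions (strict new minima) of `f` on `[0, J]`, with `f ∘ e` strictly decreasing, the
  COVER property «every `i ≤ J` is dominated by a record `e_s ≤ i` with `f(e_s) ≤ f(i)`», and `e_μ = J` when `J` is a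
  record (`Nat.nth` on the finite record set).
* **`exists_record_staircase`** — for `q` coprime to `n` and a class `a`: a staircase `(c_s, j_s)_{s ≤ μ}`,
  `c` non-increasing, `j` non-decreasing (`j_0 = 0`, `c_μ = 0`, strict on `[0, μ]`, constant beyond),
  `c_s = (a − q j_s) mod n`, all of class `a`, whose monomials `u^{c_s} v^{j_s}` GENERATE `M a` over `U`
  (a monomial `u^α v^β` of class `a` is an invariant multiple of the record generator below `min(β, J)`).
* **`exists_isSyzygy_one_isotypic`** — hence every piece `M a` has a first syzygy module of the form
  `Π_{t : Fin μ} M (a − (c_t + q j_{t+1}))` (part 21), i.e. `Ω M_a ∈ add (Π_b M_b)`: the input `hK` of the `Sat₄`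
  certificate (`…CyclicQuotientIsotypic.cohomologyAnnihilator_eq_four_of_isotypicData`) exists for every `(n, q, a)`;
  only the identification of the drop classes with the `i`-series (S4) and the block lemma (S5) remain between this
  and `ca(U) = ca⁴(U)` on the whole cyclic class.

References: folklore; res-L1-w44b-idea-1 SC-TORIC v2 §2(e)(1) (OURS, memo) for the statement being typed.
-/

-- single-problem summit: the doubled namespace component `ResolutionOfSingularities` is forced
set_option linter.dupNamespace false

noncomputable section

open CategoryTheory Literature.RingTheory.CohomologyAnnihilator MvPolynomial
open Summit.ResolutionOfSingularities.ResolutionOfSingularities.Theorems.HomologicalConductor.PersistenceCyclicQuotientSurface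
open Summit.ResolutionOfSingularities.ResolutionOfSingularities.Theorems.HomologicalConductor.PersistenceCyclicQuotientIsotypicPieces
open Summit.ResolutionOfSingularities.ResolutionOfSingularities.Theorems.HomologicalConductor.PersistenceStaircaseResolution

universe u

namespace Summit.ResolutionOfSingularities.ResolutionOfSingularities.Theorems.HomologicalConductor.PersistenceStaircaseRecords

/-! ## Records of a sequence on an initial segment -/

/-- **Record enumeration.**  For `f : ℕ → ℕ` and `J : ℕ` there are `μ` and a non-decreasing `e : ℕ → ℕ`, strictly
increasing on `[0, μ]` and constant beyond, `e 0 = 0`, `e s ≤ J` on `[0, μ]`, enumerating the RECORD positions of `f`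
(strict new minima) on `[0, J]`: `f (e t) < f (e s)` for `s < t ≤ μ`; every `i ≤ J` is COVERED by a record
`e s ≤ i` with `f (e s) ≤ f i`; and `e μ = J` whenever `J` itself is a record. [folklore] -/
theorem exists_record_enum (f : ℕ → ℕ) (J : ℕ) :
    ∃ (μ : ℕ) (e : ℕ → ℕ), e 0 = 0 ∧ (∀ s, s ≤ μ → e s ≤ J) ∧ (∀ s, μ ≤ s → e s = e μ) ∧ Monotone e ∧
      (∀ s t, s < t → t ≤ μ → e s < e t) ∧ (∀ s t, s < t → t ≤ μ → f (e t) < f (e s)) ∧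
      (∀ i, i ≤ J → ∃ s, s ≤ μ ∧ e s ≤ i ∧ f (e s) ≤ f i) ∧
      ((∀ i, i < J → f J < f i) → e μ = J) := by
  classical
  -- the record predicate
  let p : ℕ → Prop := fun i => i ≤ J ∧ ∀ i', i' < i → f i < f i'
  have hp0 : p 0 := ⟨Nat.zero_le _, fun i' h => absurd h (Nat.not_lt_zero _)⟩
  have hfin : (setOf p).Finite := (Set.finite_Iic J).subset fun i hi => hi.1
  set N := hfin.toFinset.card with hN
  have hNpos : 0 < N := Finset.card_pos.mpr ⟨0, hfin.mem_toFinset.mpr hp0⟩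
  obtain ⟨μ, hμ⟩ : ∃ μ, N = μ + 1 := ⟨N - 1, by omega⟩
  let e : ℕ → ℕ := fun s => Nat.nth p (min s μ)
  have he : ∀ s, e s = Nat.nth p (min s μ) := fun _ => rfl
  have hlt : ∀ s, min s μ < N := fun s => by rw [hμ]; exact Nat.lt_succ_of_le (min_le_right _ _)
  have hmem : ∀ s, p (e s) := fun s => Nat.nth_mem_of_lt_card hfin (hlt s)
  refine ⟨μ, e, ?_, ?_, ?_, ?_, ?_, ?_, ?_, ?_⟩
  · rw [he, Nat.zero_min]; exact Nat.nth_zero_of_zero hp0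
  · intro s _; exact (hmem s).1
  · intro s hs; rw [he, he, min_eq_right hs, min_self]
  · intro s t hst
    rw [he, he]
    exact Nat.nth_le_nth_of_lt_card hfin (min_le_min_right μ hst) (hlt t)
  · intro s t hst htμ
    rw [he, he, min_eq_left htμ, min_eq_left (le_of_lt (lt_of_lt_of_le hst htμ))]
    exact Nat.nth_lt_nth_of_lt_card hfin hst (by omega)
  · intro s t hst htμ
    have hlt' : e s < e t := by
      rw [he, he, min_eq_left htμ, min_eq_left (le_of_lt (lt_of_lt_of_le hst htμ))]
      exact Nat.nth_lt_nth_of_lt_card hfin hst (by omega)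
    exact (hmem t).2 _ hlt'
  · intro i hi
    -- a minimiser of `f` on `[0, i]` of least index is a record
    have hex : ∃ r, r ≤ i ∧ ∀ x, x ≤ i → f r ≤ f x := by
      obtain ⟨r, hr, hmin⟩ := (Finset.range (i + 1)).exists_min_image f ⟨0, by simp⟩
      exact ⟨r, Nat.le_of_lt_succ (Finset.mem_range.mp hr), fun x hx => hmin x (Finset.mem_range.mpr (by omega))⟩
    let r := Nat.find hex
    have hr : r ≤ i ∧ ∀ x, x ≤ i → f r ≤ f x := Nat.find_spec hex
    have hrec : p r := by
      refine ⟨hr.1.trans hi, fun i' hi' => ?_⟩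
      by_contra hle
      push Not at hle
      exact Nat.find_min hex hi' ⟨le_of_lt (lt_of_lt_of_le hi' hr.1), fun x hx => hle.trans (hr.2 x hx)⟩
    obtain ⟨s, hs, hse⟩ := Nat.exists_lt_card_finite_nth_eq hfin hrec
    have hsμ : s ≤ μ := by omega
    refine ⟨s, hsμ, ?_, ?_⟩
    · rw [he, min_eq_left hsμ, hse]; exact hr.1
    · rw [he, min_eq_left hsμ, hse]; exact hr.2 i le_rfl
  · intro hJ
    have hpJ : p J := ⟨le_rfl, hJ⟩
    obtain ⟨s, hs, hse⟩ := Nat.exists_lt_card_finite_nth_eq hfin hpJ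
    have hsμ : s ≤ μ := by omega
    refine le_antisymm (hmem μ).1 ?_
    rw [← hse, he, min_self]
    exact Nat.nth_le_nth_of_lt_card hfin hsμ (by omega)

/-! ## The record staircase of a weight class -/

section Stair

variable {k : Type u} [Field k] {n : ℕ} [NeZero n] {ζ : k} (hζ : IsPrimitiveRoot ζ n)
variable {q : ℕ} (hq : q.Coprime n) (U : Subalgebra k (MvPolynomial (Fin 2) k))
variable (hU : ∀ p, p ∈ U ↔ aeval (fun i : Fin 2 => C (ζ ^ (![1, q] : Fin 2 → ℕ) i) * X i) p = p)
variable (M : ZMod n → Submodule U ((restrictScalarsFunctor U (MvPolynomial (Fin 2) k)).obj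
  (ModuleCat.of (MvPolynomial (Fin 2) k) (MvPolynomial (Fin 2) k))))
variable (hM : ∀ (a : ZMod n) (p : MvPolynomial (Fin 2) k),
  (show ((restrictScalarsFunctor U (MvPolynomial (Fin 2) k)).obj
    (ModuleCat.of (MvPolynomial (Fin 2) k) (MvPolynomial (Fin 2) k))) from p) ∈ M a ↔
  aeval (fun i : Fin 2 => C (ζ ^ (![1, q] : Fin 2 → ℕ) i) * X i) p = C (ζ ^ a.val) * p)

include hζ hU hM in
/-- **GENERATION FROM A COVERING STAIRCASE.**  Let `(c_s, j_s)_{s ≤ μ}` be monomial exponents of class `a`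
(`c_s + q j_s ≡ a`) and `J` with `q J ≡ a`.  If every `i ≤ J` is COVERED — some `s ≤ μ` has `j_s ≤ i` and
`c_s ≤ (a − q i) mod n` — then the monomials `u^{c_s} v^{j_s}` generate the piece `M a` over `U`: a monomial
`u^α v^β` of class `a` is the invariant monomial `u^{α − c_s} v^{β − j_s}` times the generator covering `min(β, J)`.
(A decidable criterion for explicit staircases; the record staircase satisfies it.) [folklore; OURS · L1 w44b] -/
theorem isotypic_le_span_of_cover (a : ZMod n) (μ J : ℕ) (c j : ℕ → ℕ)
    (hcl : ∀ s, ((c s + q * j s : ℕ) : ZMod n) = a) (hJ : ((q * J : ℕ) : ZMod n) = a)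
    (hcover : ∀ i, i ≤ J → ∃ s, s ≤ μ ∧ j s ≤ i ∧ c s ≤ ((a - ((q * i : ℕ) : ZMod n) : ZMod n)).val) :
    M a ≤ Submodule.span U (Set.range fun s : Fin (μ + 1) =>
      (show ((restrictScalarsFunctor U (MvPolynomial (Fin 2) k)).obj
          (ModuleCat.of (MvPolynomial (Fin 2) k) (MvPolynomial (Fin 2) k))) from
            monomial (Finsupp.single 0 (c s) + Finsupp.single 1 (j s)) (1 : k))) := by
  classical
  intro w hw
  let toWh : MvPolynomial (Fin 2) k →+ ((restrictScalarsFunctor U (MvPolynomial (Fin 2) k)).obj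
          (ModuleCat.of (MvPolynomial (Fin 2) k) (MvPolynomial (Fin 2) k))) :=
    { toFun := fun p => p, map_zero' := rfl, map_add' := fun _ _ => rfl }
  let ofW : ((restrictScalarsFunctor U (MvPolynomial (Fin 2) k)).obj
          (ModuleCat.of (MvPolynomial (Fin 2) k) (MvPolynomial (Fin 2) k))) → MvPolynomial (Fin 2) k := fun w => w
  have hsupp : ∀ d ∈ (ofW w).support, ((d 0 + q * d 1 : ℕ) : ZMod n) = a :=
    (rootAut_eq_C_mul_iff hζ q a (ofW w)).mp ((hM a (ofW w)).mp hw)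
  have hw' : w = toWh (∑ d ∈ (ofW w).support, monomial d (coeff d (ofW w))) :=
    congr_arg toWh (ofW w).as_sum
  rw [hw', map_sum]
  refine Submodule.sum_mem _ fun d hd => ?_
  -- the covering generator below `min (d 1) J`
  obtain ⟨s, hsμ, hjs', hcs'⟩ := hcover (min (d 1) J) (min_le_right _ _)
  have hc₀le : ((a - ((q * min (d 1) J : ℕ) : ZMod n) : ZMod n)).val ≤ d 0 := by
    by_cases hβ : d 1 ≤ J
    · rw [min_eq_left hβ]
      have : ((d 0 : ℕ) : ZMod n) = a - ((q * d 1 : ℕ) : ZMod n) := by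
        rw [← hsupp d hd, Nat.cast_add]; ring
      rw [← this, ZMod.val_natCast]
      exact Nat.mod_le _ _
    · push Not at hβ
      rw [min_eq_right (le_of_lt hβ), ← hJ, sub_self, ZMod.val_zero]
      exact Nat.zero_le _
  have hcs : c s ≤ d 0 := hcs'.trans hc₀le
  have hjs : j s ≤ d 1 := hjs'.trans (min_le_left _ _)
  -- the invariant cofactor
  let r : Fin 2 →₀ ℕ := Finsupp.single 0 (d 0 - c s) + Finsupp.single 1 (d 1 - j s)
  have hexp : r + (Finsupp.single 0 (c s) + Finsupp.single 1 (j s)) = d := by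
    ext i; fin_cases i
    · simp [r]; omega
    · simp [r]; omega
  have hrU : monomial r (coeff d (ofW w)) ∈ U := by
    rw [hU, rootAut_eq_self_iff hζ]
    intro d' hd'
    rw [support_monomial] at hd'
    split_ifs at hd' with h0
    · exact absurd hd' (Finset.notMem_empty _)
    · rw [Finset.mem_singleton] at hd'
      subst hd'
      rw [← ZMod.natCast_eq_zero_iff]
      have h1 := hsupp d hd
      have h2 := hcl s
      have heq : (((r 0 + q * r 1 : ℕ) : ZMod n)) + ((c s + q * j s : ℕ) : ZMod n) =
          ((d 0 + q * d 1 : ℕ) : ZMod n) := by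
        push_cast
        simp only [r, Finsupp.coe_add, Pi.add_apply, Finsupp.single_eq_same, Finsupp.single_eq_of_ne (one_ne_zero),
          Finsupp.single_eq_of_ne (zero_ne_one), add_zero, zero_add]
        rw [Nat.cast_sub hcs, Nat.cast_sub hjs]
        ring
      rw [h1, h2] at heq
      exact add_eq_right.mp heq
  have hdecomp : toWh (monomial d (coeff d (ofW w))) = (⟨monomial r (coeff d (ofW w)), hrU⟩ : U) •
      toWh (monomial (Finsupp.single 0 (c s) + Finsupp.single 1 (j s)) 1) := by
    change monomial d (coeff d (ofW w)) =
      monomial r (coeff d (ofW w)) * monomial (Finsupp.single 0 (c s) + Finsupp.single 1 (j s)) 1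
    rw [monomial_mul, mul_one, hexp]
  rw [hdecomp]
  exact Submodule.smul_mem _ _ (Submodule.subset_span ⟨⟨s, Nat.lt_succ_of_le hsμ⟩, rfl⟩)

include hζ hq hU hM in
/-- **THE RECORD STAIRCASE GENERATES `M_a`.**  For `q` coprime to `n` and `a : ZMod n` there is a staircase
`(c_s, j_s)_s` — `c` non-increasing, `j` non-decreasing with `j_0 = 0`, strictly monotone on `[0, μ]`, constant
beyond, `c_s = (a − q j_s) mod n` (so every `u^{c_s}v^{j_s}` has class `a`), `c_μ = 0` — whose monomials
`u^{c_s} v^{j_s}`, `s ≤ μ`, generate the piece `M a` over `U`. [folklore; OURS · L1 w44b] -/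
theorem exists_record_staircase (a : ZMod n) :
    ∃ (μ : ℕ) (c j : ℕ → ℕ), Antitone c ∧ Monotone j ∧ j 0 = 0 ∧ c μ = 0 ∧
      (∀ s, c s = ((a - ((q * j s : ℕ) : ZMod n) : ZMod n)).val) ∧
      (∀ s, ((c s + q * j s : ℕ) : ZMod n) = a) ∧
      (∀ s t, s < t → t ≤ μ → c t < c s ∧ j s < j t) ∧ (∀ s, μ ≤ s → j s = j μ) ∧
      M a ≤ Submodule.span U (Set.range fun s : Fin (μ + 1) =>
        (show ((restrictScalarsFunctor U (MvPolynomial (Fin 2) k)).obj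
          (ModuleCat.of (MvPolynomial (Fin 2) k) (MvPolynomial (Fin 2) k))) from
            monomial (Finsupp.single 0 (c s) + Finsupp.single 1 (j s)) (1 : k))) := by
  classical
  -- `c₀ i = (a − q i) mod n`
  let c₀ : ℕ → ℕ := fun i => ((a - ((q * i : ℕ) : ZMod n) : ZMod n)).val
  have hc₀ : ∀ i, c₀ i = ((a - ((q * i : ℕ) : ZMod n) : ZMod n)).val := fun _ => rfl
  have hcl₀ : ∀ i, ((c₀ i + q * i : ℕ) : ZMod n) = a := fun i => by
    rw [Nat.cast_add, hc₀, ZMod.natCast_zmod_val, sub_add_cancel]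
  -- the last position `J`: `q J ≡ a`
  have hexJ : ∃ i, c₀ i = 0 := by
    refine ⟨(a * ((q : ZMod n))⁻¹).val, ?_⟩
    rw [hc₀, ZMod.val_eq_zero, Nat.cast_mul, ZMod.natCast_zmod_val, mul_left_comm, ZMod.coe_mul_inv_eq_one q hq,
      mul_one, sub_self]
  let J := Nat.find hexJ
  have hJ0 : c₀ J = 0 := Nat.find_spec hexJ
  have hJrec : ∀ i, i < J → c₀ J < c₀ i := fun i hi => by
    rw [hJ0]; exact Nat.pos_of_ne_zero (Nat.find_min hexJ hi)
  obtain ⟨μ, e, he0, heJ, heμ, hemono, hestrict, hfe, hcover, helast⟩ := exists_record_enum c₀ J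
  have heμJ : e μ = J := helast hJrec
  refine ⟨μ, fun s => c₀ (e s), e, ?_, hemono, he0, ?_, fun s => rfl, fun s => hcl₀ (e s), ?_, heμ, ?_⟩
  · -- `c` antitone
    intro s t hst
    change c₀ (e t) ≤ c₀ (e s)
    rcases eq_or_lt_of_le hst with rfl | hlt
    · exact le_rfl
    by_cases htμ : t ≤ μ
    · exact le_of_lt (hfe s t hlt htμ)
    · push Not at htμ
      rw [heμ t (le_of_lt htμ)]
      by_cases hsμ : s < μ
      · exact le_of_lt (hfe s μ hsμ le_rfl)
      · push Not at hsμ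
        rw [heμ s hsμ]
  · change c₀ (e μ) = 0
    rw [heμJ, hJ0]
  · intro s t hst htμ
    exact ⟨hfe s t hst htμ, hestrict s t hst htμ⟩
  · -- generation, by the covering criterion
    refine isotypic_le_span_of_cover hζ U hU M hM a μ J (fun s => c₀ (e s)) e (fun s => hcl₀ (e s)) ?_ ?_
    · have := hcl₀ J
      rw [hJ0, zero_add] at this
      exact this
    · intro i hi
      obtain ⟨s, hsμ, hes, hfs⟩ := hcover i hi
      exact ⟨s, hsμ, hes, hfs⟩

include hζ hq hU hM in
/-- **Every isotypic piece has a first syzygy that is a finite product of isotypic pieces** — the greedy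
syzygy formula in existence form: for each `a` there are `μ`, a staircase `(c, j)` as in
`exists_record_staircase`, and `IsSyzygy 1 (M a) (Π_{t : Fin μ} M (a − (c_t + q j_{t+1})))`. [OURS · L1 w44b] -/
theorem exists_isSyzygy_one_isotypic (a : ZMod n) :
    ∃ (μ : ℕ) (c j : ℕ → ℕ), Antitone c ∧ Monotone j ∧ j 0 = 0 ∧ c μ = 0 ∧
      (∀ s, c s = ((a - ((q * j s : ℕ) : ZMod n) : ZMod n)).val) ∧
      (∀ s t, s < t → t ≤ μ → c t < c s ∧ j s < j t) ∧ (∀ s, μ ≤ s → j s = j μ) ∧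
      IsSyzygy 1 (@ModuleCat.of U _ (M a) _ (M a).module)
        (ModuleCat.of U (Π t : Fin μ, M (a - ((c t + q * j (t + 1) : ℕ) : ZMod n)))) := by
  obtain ⟨μ, c, j, hc, hj, hj0, hcμ, hcdef, hcl, hstrict, hjμ, hgen⟩ := exists_record_staircase hζ hq U hU M hM a
  exact ⟨μ, c, j, hc, hj, hj0, hcμ, hcdef, hstrict, hjμ,
    isSyzygy_one_staircase hζ q U hU M hM a μ c j hc hj hcl (fun t => a - ((c t + q * j (t + 1) : ℕ) : ZMod n))
      (fun _ => rfl) hgen⟩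

include hζ hU hM in
/-- **The staircase resolution with the drop classes prescribed only below `μ`** (part 21's
`isSyzygy_one_staircase` transported along `M (ψ t) = M (a − (c_t + q j_{t+1}))` for `t < μ`): the form in which
explicit certificates and the general drop-class bookkeeping consume it. [OURS · L1 w44b] -/
theorem isSyzygy_one_staircase_of_lt (a : ZMod n) (μ : ℕ) (c j : ℕ → ℕ) (hc : Antitone c) (hj : Monotone j)
    (hcl : ∀ s, ((c s + q * j s : ℕ) : ZMod n) = a) (ψ : ℕ → ZMod n)
    (hψ : ∀ t, t < μ → ψ t = a - ((c t + q * j (t + 1) : ℕ) : ZMod n))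
    (hgen : M a ≤ Submodule.span U (Set.range fun s : Fin (μ + 1) =>
      (show ((restrictScalarsFunctor U (MvPolynomial (Fin 2) k)).obj
        (ModuleCat.of (MvPolynomial (Fin 2) k) (MvPolynomial (Fin 2) k))) from
          monomial (Finsupp.single 0 (c s) + Finsupp.single 1 (j s)) (1 : k)))) :
    IsSyzygy 1 (@ModuleCat.of U _ (M a) _ (M a).module) (ModuleCat.of U (Π t : Fin μ, M (ψ t))) := by
  have h := isSyzygy_one_staircase hζ q U hU M hM a μ c j hc hj hcl
    (fun t => a - ((c t + q * j (t + 1) : ℕ) : ZMod n)) (fun _ => rfl) hgen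
  refine h.of_iso (LinearEquiv.toModuleIso (LinearEquiv.piCongrRight fun t : Fin μ =>
    LinearEquiv.ofEq _ _ ?_))
  rw [hψ t t.isLt]

end Stair

end Summit.ResolutionOfSingularities.ResolutionOfSingularities.Theorems.HomologicalConductor.PersistenceStaircaseRecords

end
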